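import Literature.AnabelianGeometry.AbsoluteAnabelian.MonoidKummerGaloisCyclotomeHomNaturality
import Literature.AnabelianGeometry.AbsoluteAnabelian.MonoidKummerMapsIdRigidProofs
import Literature.AnabelianGeometry.AbsoluteAnabelian.GaloisCyclotomeOpenEmbeddingComp
import HarnessLib

/-!
# [AbsTopIII] Prop 3.2 (ii) with `μ_Ẑ(G)`-coefficients: the ISOMORPHISM legs in the `Hom` currency —
# `β(ι f) = ᾱ(f)`, `μ_Ẑ(β(ι f)) = μ_Ẑ(ᾱ(f))`, the coefficient square for `ι f`, naturality UNCONDITIONALLY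

S. Mochizuki, *Topics in Absolute Anabelian Geometry III*, §3 (bib key `MochizukiAbsTopIII2015`; kurims
manuscript pages, lit key `paper:url-5493eb38cbb7`): Def. 3.1 (ii) p. 67 (morphisms / isomorphisms of
MLF-Galois `TM`-pairs; the Galois component «induces an open injective homomorphism between the respective
arithmetic Galois groups»), Prop. 3.2 (ii) p. 71 l. 58 – p. 72 l. 6 («functorial algorithms … Kummer maps
`M^H_TM → H¹(H, μ_Ẑ(M_TM))` … the «`μ_Ẑ(M_TM)`» may be replaced by «`μ_Ẑ(G)`» [cf. Remark 3.2.1 below]»),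
Rmk. 3.2.1 p. 73, Cor. 1.10 (i) p. 42 (functoriality of `μ_Ẑ(G)` «with respect to arbitrary injective open
homomorphisms»).

THE POINT (abc-iut cell, layer L4, node AbsTopIII:Prop3.2(ii); the junction item «(j0)» named by the
count-question read abc-iut-f-075 2026-08-26T12:23:47Z: «(Iso→Hom).absGaloisHom = absGaloisIso as maps» +
«mapOfOpenEmbedding along a ContinuousMulEquiv = muZhat.map» ⇒ hsq(ι f) from the iso square).  The tree proves
the naturality of the `μ_Ẑ(G)`-valued Kummer maps of model `TM`-pairs in TWO currencies:
* along ISOMORPHISMS `f` (abc-iut-L4-t2 `MLFGaloisTMIsoUnitsTransport` p441441 /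
  `MonoidKummerGaloisCyclotomeCanonical` p441742): coefficient identification `μ_Ẑ(ᾱ(f)) = muZhat.map f.absGaloisIso`,
  square `GaloisMonoidPair.Iso.cyclotome_map_rootsHom_muZhat_map` for THE reciprocity data;
* along MORPHISMS `φ` of Def. 3.1 (ii) (`MonoidKummerGaloisCyclotomeHomNaturality` p443542): coefficient
  identification the group-theoretic `μ_Ẑ(β(φ))` of Cor. 1.10 (i) along the covered open injection
  `β(φ) = φ.absGaloisHom` (`muZhat.mapOfOpenEmbedding`), naturality
  `pullMuZhat_kummerMuZhat_eq_pushMuZhat_of_square` MODULO the coefficient square `hsq`; `hsq` discharged for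
  the field-restriction legs (`MonoidKummerGaloisCyclotomeRestriction(Witness)` p446357 / p447231) and REFUTED
  along the power endomorphisms (`kummerMuZhat_powEnd_ne`).
This PROOF-ONLY file joins the two for the isomorphism legs: for an isomorphism `f` of model `TM`-pairs read
as a morphism `ι f := f.toHom` (abc-iut-w4-d045 `GaloisMonoidPair.Iso.toHom`),
* `toHom_galoisHom_apply` / `toHom_absGaloisHom_apply` / `toHom_absGaloisHom`: the covered open injection of
  `ι f` IS the covered Galois isomorphism `ᾱ(f)` (uniqueness of the covered homomorphism, `eq_galoisHom_of_aug`);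
* `toHom_muZhatMap_apply`: `μ_Ẑ(β(ι f)) = muZhat.map (ᾱ(f))` (abc-iut-L4-d3
  `muZhat.mapOfOpenEmbedding_coe_continuousMulEquiv`, Cor. 1.10 (i) along an isomorphism);
* `toHom_coeffSquare`: the coefficient square `hsq` HOLDS for `ι f` and THE data (from p441441's iso square);
* `pullMuZhat_kummerMuZhat_eq_pushMuZhat_toHom` (+ `_mapOpen` at `H₂ = f_Π(H₁)`, + `_of_compactSpace`):
  Prop. 3.2 (ii)'s `μ_Ẑ(G)`-valued Kummer maps are natural along `ι f` in the `Hom` currency with NO residual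
  hypothesis beyond the open augmentations (print's «quotient `Π ↠ G`»; automatic for compact `Π`).
With p446357/p447231 (restriction legs) this makes the `Hom`-currency naturality unconditional on both kinds
of legs through which every injective open homomorphism of absolute Galois groups factors (abc-iut-L4-d3
`exists_eq_conj_absGaloisRestrict_comp`: isomorphism ∘ restriction ∘ inner), while along a general morphism of
`𝒞^MLF_TM` it holds exactly modulo `hsq` (and fails for `(𝟙, x ↦ x²)`).

No definition, no `Prop`-valued definition, no instance; every input consumed BY NAME.  Universe `0`.
HONEST FRAMING: classical Kummer theory / local class field theory as proved in the tree; nothing here bears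
on [IUTchIII] Cor. 3.12; no side is taken; nothing asserts that abc is proved or refuted.
-/

noncomputable section

open scoped nonZeroDivisors

namespace Literature.AnabelianGeometry.AbsoluteAnabelian

open Function Field
open Literature.NumberTheory.GaloisRepresentations

/-! ### §0 Transport of `μ_Ẑ(β)` along an equality of open injections -/

section Congr

variable {G : Type} [Group G] [TopologicalSpace G] [IsTopologicalGroup G] [CompactSpace G]
  {G' : Type} [Group G'] [TopologicalSpace G'] [IsTopologicalGroup G'] [CompactSpace G'] [T2Space G']

/-- `μ_Ẑ(β)` depends only on the homomorphism `β`, not on the chosen proofs of injectivity / openness.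
[cite: MochizukiAbsTopIII2015, Cor 1.10 (i) p.42] -/
theorem muZhat.mapOfOpenEmbedding_congr_hom {β β' : G →ₜ* G'} (h : β = β') (hinj : Injective β)
    (hopen : IsOpen (Set.range β)) (hinj' : Injective β') (hopen' : IsOpen (Set.range β')) (ζ : muZhat G) :
    muZhat.mapOfOpenEmbedding β hinj hopen ζ = muZhat.mapOfOpenEmbedding β' hinj' hopen' ζ := by
  subst h
  rfl

end Congr

namespace GaloisMonoidPair.Iso

variable {C₁ C₂ : MLFClosure.{0}} {D₁ : ModelMLFGaloisData C₁.k C₁.K} {D₂ : ModelMLFGaloisData C₂.k C₂.K}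
  (f : GaloisMonoidPair.Iso D₁.tmPair D₂.tmPair)

/-! ### §1 The covered open injection of `ι f` is the covered Galois isomorphism `ᾱ(f)` -/

/-- **`β(ι f) = ᾱ(f)` on `Gal(k̄/k)`**: the homomorphism of arithmetic Galois groups covered by `f_Π` read as a
morphism is the Galois isomorphism covered by `f_Π` (both are THE homomorphism `β` with `β ∘ ε₁ = ε₂ ∘ f_Π`).
[cite: MochizukiAbsTopIII2015, Definition 3.1 (ii) p.67] -/
theorem toHom_galoisHom_apply (σ : C₁.K ≃ₐ[C₁.k] C₁.K) : f.toHom.galoisHom σ = f.galoisIso σ :=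
  (f.toHom.eq_galoisHom_of_aug f.galoisIso.toMonoidHom (fun g => f.galoisIso_aug g) σ).symm

/-- **`β(ι f) = ᾱ(f)` on Mathlib's absolute Galois groups**, pointwise (`ε₁` open).
[cite: MochizukiAbsTopIII2015, Definition 3.1 (ii) p.67] -/
theorem toHom_absGaloisHom_apply (h₁ : IsOpenMap D₁.aug) (σ : absoluteGaloisGroup C₁.k) :
    f.toHom.absGaloisHom h₁ σ = f.absGaloisIso σ := by
  change algEquivContinuousMulEquivAbsoluteGaloisGroup C₂.k C₂.K
      (f.toHom.galoisHom ((algEquivContinuousMulEquivAbsoluteGaloisGroup C₁.k C₁.K).symm σ)) =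
    algEquivContinuousMulEquivAbsoluteGaloisGroup C₂.k C₂.K
      (f.galoisIso ((algEquivContinuousMulEquivAbsoluteGaloisGroup C₁.k C₁.K).symm σ))
  rw [toHom_galoisHom_apply]

/-- **`β(ι f) = ᾱ(f)` as continuous homomorphisms `G_{k₁} →ₜ* G_{k₂}`.**
[cite: MochizukiAbsTopIII2015, Definition 3.1 (ii) p.67] -/
theorem toHom_absGaloisHom (h₁ : IsOpenMap D₁.aug) :
    f.toHom.absGaloisHom h₁ = (f.absGaloisIso : absoluteGaloisGroup C₁.k →ₜ* absoluteGaloisGroup C₂.k) :=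
  ContinuousMonoidHom.ext fun σ => f.toHom_absGaloisHom_apply h₁ σ

/-! ### §2 `μ_Ẑ(β(ι f)) = μ_Ẑ(ᾱ(f))` and the coefficient square for `ι f` -/

/-- **Cor. 1.10 (i) along an isomorphism, in the `Hom` currency: `μ_Ẑ(β(ι f)) = muZhat.map ᾱ(f)`** — the
group-theoretic coefficient identification of `MonoidKummerGaloisCyclotomeHomNaturality` for `ι f` is the
transport of structure along `ᾱ(f)` used by `MLFGaloisTMIsoUnitsTransport`.
[cite: MochizukiAbsTopIII2015, Cor 1.10 (i) p.42] -/
theorem toHom_muZhatMap_apply (h₁ : IsOpenMap D₁.aug) (h₂ : IsOpenMap D₂.aug)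
    (ζ : muZhat (absoluteGaloisGroup C₁.k)) :
    f.toHom.muZhatMap h₁ h₂ ζ = muZhat.map f.absGaloisIso ζ := by
  have hinj : Injective (f.absGaloisIso : absoluteGaloisGroup C₁.k →ₜ* absoluteGaloisGroup C₂.k) :=
    f.absGaloisIso.injective
  have hopen : IsOpen (Set.range (f.absGaloisIso : absoluteGaloisGroup C₁.k →ₜ* absoluteGaloisGroup C₂.k)) := by
    have : Set.range (f.absGaloisIso : absoluteGaloisGroup C₁.k →ₜ* absoluteGaloisGroup C₂.k) = Set.univ :=
      Set.range_eq_univ.mpr f.absGaloisIso.surjective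
    rw [this]
    exact isOpen_univ
  rw [GaloisMonoidPair.Hom.muZhatMap, muZhat.mapOfOpenEmbedding_congr_hom (f.toHom_absGaloisHom h₁)
    (f.toHom.absGaloisHom_injective h₁) (f.toHom.isOpen_range_absGaloisHom h₁ h₂) hinj hopen]
  exact muZhat.mapOfOpenEmbedding_coe_continuousMulEquiv f.absGaloisIso hinj hopen ζ

/-- **The coefficient square `hsq` HOLDS for `ι f` and THE reciprocity data**:
`Λ(rootsHom₂) ∘ μ_Ẑ(β(ι f)) = Λ((ι f)_M^gp) ∘ Λ(rootsHom₁)` on `μ_Ẑ(G_{k₁})` (Rmk. 3.2.1's identifications built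
from `TorsionReciprocityData.fundamental`; from the iso square `cyclotome_map_rootsHom_muZhat_map`).
[cite: MochizukiAbsTopIII2015, Remark 3.2.1 p.73] -/
theorem toHom_coeffSquare (h₁ : IsOpenMap D₁.aug) (h₂ : IsOpenMap D₂.aug)
    (ζ : muZhat (absoluteGaloisGroup C₁.k)) :
    EtaleTheta.cyclotome.map (ModelMLFGaloisData.rootsHom C₂ (TorsionReciprocityData.fundamental C₂.k))
        (f.toHom.muZhatMap h₁ h₂ ζ) =
      EtaleTheta.cyclotome.map (ModelMLFGaloisData.unitsLift f.toHom.homM)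
        (EtaleTheta.cyclotome.map (ModelMLFGaloisData.rootsHom C₁ (TorsionReciprocityData.fundamental C₁.k)) ζ) := by
  rw [toHom_muZhatMap_apply]
  exact f.cyclotome_map_rootsHom_muZhat_map ζ

/-! ### §3 Prop 3.2 (ii) naturality along `ι f`, unconditionally -/

/-- **[AbsTopIII] Prop 3.2 (ii) with `μ_Ẑ(G)`-coefficients along an ISOMORPHISM read as a morphism,
UNCONDITIONALLY for THE data.**  For an isomorphism `f : (Π₁ ↷ 𝒪_k̄₁^⊳) ⥲ (Π₂ ↷ 𝒪_k̄₂^⊳)` of model MLF-Galois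
`TM`-pairs (open augmentations), open `H₁ ⊆ Π₁`, `H₂ ⊆ Π₂` with `f_Π(H₁) ⊆ H₂` and `m ∈ (𝒪_k̄₁^⊳)^{H₁}` with
`f_M(m) ∈ (𝒪_k̄₂^⊳)^{H₂}`: `(ι f)_Π^* (κ^G_{H₂}(f_M m)) = μ_Ẑ(β(ι f))_* (κ^G_{H₁}(m))` in
`H¹(H₁, res μ_Ẑ(G_{k₂}))` — the `Hom`-currency naturality of `MonoidKummerGaloisCyclotomeHomNaturality` with its
coefficient-square hypothesis DISCHARGED. [cite: MochizukiAbsTopIII2015, Proposition 3.2 (ii) p.72] -/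
theorem pullMuZhat_kummerMuZhat_eq_pushMuZhat_toHom (h₁ : IsOpenMap D₁.aug) (h₂ : IsOpenMap D₂.aug)
    {H₁ : OpenSubgroup D₁.tmPair.Pi} {H₂ : OpenSubgroup D₂.tmPair.Pi}
    (hH : (H₁ : Subgroup D₁.Pi).map f.toHom.homPi ≤ (H₂ : Subgroup D₂.Pi))
    (m : {m : D₁.tmPair.M // ∀ h : H₁, (h : D₁.tmPair.Pi) • m = m})
    (hm : ∀ h : H₂, (h : D₂.tmPair.Pi) • f.toHom.homM m.1 = f.toHom.homM m.1) :
    f.toHom.pullMuZhat (TorsionReciprocityData.fundamental C₂.k) hH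
        (ModelMLFGaloisData.kummerMuZhat C₂ D₂ (TorsionReciprocityData.fundamental C₂.k) H₂ ⟨f.toHom.homM m.1, hm⟩) =
      f.toHom.pushMuZhat h₁ h₂ (TorsionReciprocityData.fundamental C₁.k) (TorsionReciprocityData.fundamental C₂.k) hH
        (ModelMLFGaloisData.kummerMuZhat C₁ D₁ (TorsionReciprocityData.fundamental C₁.k) H₁ m) :=
  f.toHom.pullMuZhat_kummerMuZhat_eq_pushMuZhat_of_square h₁ h₂ _ _ hH (f.toHom_coeffSquare h₁ h₂) m hm

/-- **The same at `H₂ = f_Π(H₁)`** (`Iso.mapOpen`): for every open `H₁ ⊆ Π₁` and `m ∈ (𝒪_k̄₁^⊳)^{H₁}` — no side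
condition on `H₂` or `m` left. [cite: MochizukiAbsTopIII2015, Proposition 3.2 (ii) p.72] -/
theorem pullMuZhat_kummerMuZhat_eq_pushMuZhat_toHom_mapOpen (h₁ : IsOpenMap D₁.aug) (h₂ : IsOpenMap D₂.aug)
    (H₁ : OpenSubgroup D₁.tmPair.Pi) (m : {m : D₁.tmPair.M // ∀ h : H₁, (h : D₁.tmPair.Pi) • m = m}) :
    f.toHom.pullMuZhat (H₂ := f.mapOpen H₁) (TorsionReciprocityData.fundamental C₂.k) le_rfl
        (ModelMLFGaloisData.kummerMuZhat C₂ D₂ (TorsionReciprocityData.fundamental C₂.k) (f.mapOpen H₁)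
          ⟨f.toHom.homM m.1, by
            rintro ⟨_, g, hg, rfl⟩
            exact f.smul_isoM_of_mem m.1 m.2 g hg⟩) =
      f.toHom.pushMuZhat (H₂ := f.mapOpen H₁) h₁ h₂ (TorsionReciprocityData.fundamental C₁.k)
        (TorsionReciprocityData.fundamental C₂.k) le_rfl
        (ModelMLFGaloisData.kummerMuZhat C₁ D₁ (TorsionReciprocityData.fundamental C₁.k) H₁ m) :=
  f.pullMuZhat_kummerMuZhat_eq_pushMuZhat_toHom h₁ h₂ le_rfl m _

/-- **The same for COMPACT `Π₁`, `Π₂`** (print's hyperbolic-orbicurve / profinite type: the augmentations are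
then open, abc-iut-L4-t2 `ModelMLFGaloisData.isOpenMap_aug_of_compactSpace`) — zero residual hypotheses.
[cite: MochizukiAbsTopIII2015, Proposition 3.2 (ii) p.72] -/
theorem pullMuZhat_kummerMuZhat_eq_pushMuZhat_toHom_of_compactSpace [CompactSpace D₁.Pi] [CompactSpace D₂.Pi]
    (H₁ : OpenSubgroup D₁.tmPair.Pi) (m : {m : D₁.tmPair.M // ∀ h : H₁, (h : D₁.tmPair.Pi) • m = m}) :
    f.toHom.pullMuZhat (H₂ := f.mapOpen H₁) (TorsionReciprocityData.fundamental C₂.k) le_rfl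
        (ModelMLFGaloisData.kummerMuZhat C₂ D₂ (TorsionReciprocityData.fundamental C₂.k) (f.mapOpen H₁)
          ⟨f.toHom.homM m.1, by
            rintro ⟨_, g, hg, rfl⟩
            exact f.smul_isoM_of_mem m.1 m.2 g hg⟩) =
      f.toHom.pushMuZhat (H₂ := f.mapOpen H₁) D₁.isOpenMap_aug_of_compactSpace D₂.isOpenMap_aug_of_compactSpace
        (TorsionReciprocityData.fundamental C₁.k) (TorsionReciprocityData.fundamental C₂.k) le_rfl
        (ModelMLFGaloisData.kummerMuZhat C₁ D₁ (TorsionReciprocityData.fundamental C₁.k) H₁ m) :=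
  f.pullMuZhat_kummerMuZhat_eq_pushMuZhat_toHom_mapOpen _ _ H₁ m

end GaloisMonoidPair.Iso

end Literature.AnabelianGeometry.AbsoluteAnabelian

end
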